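/-
Copyright (c) 2026. All rights reserved.
Released under Apache 2.0 license as described in the file LICENSE.
Authors: abc-iut cell, prover seat abc-iut-L6-t14 (wave 2, generation 2).
-/
import Literature.RingTheory.MvPowerSeries.AdicEvaluation
import Literature.RingTheory.MvPowerSeries.PartialDerivative
import HarnessLib

/-!
# Taylor re-expansion of a formal power series at a topologically nilpotent point

Topic `Literature/RingTheory/MvPowerSeries`. For `f ∈ A⟦X_s : s ∈ τ⟧` (`τ` finite), `A` complete
and separated for the `I`-adic topology, and a point `a ∈ I^τ`, the formal power series
`f(a + Y) ∈ A⟦Y⟧` — Bourbaki's series obtained from `f(X + Y) ∈ A⟦X, Y⟧`, *Alg. Comm.* III §4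
no. 5 formula (21), "en substituant les `aᵢ` aux `Xᵢ` dans les coefficients" (partial
substitution, loc. cit. after Prop. 6) — has as coefficient of `Y^α` the value at `a` of the
divided (Hasse) partial derivative `Δ_α f = Σ_β C(α+β, α) f_{α+β} X^β`. We define
`hasseDeriv α f = Δ_α f` and `taylorAt I a f := Σ_α (Δ_α f)(a) Y^α` through `adicEval`
(`AdicEvaluation.lean`) and prove the **Taylor expansion** `f(a + z) = (taylorAt I a f)(z)` for
`z ∈ I^τ` (`adicEval_add_eq_adicEval_taylorAt`; Bourbaki (21)–(22) with (18)), together with the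
identification of the low-order coefficients: the constant term is `f(a)` and the coefficient of
`Y_i` is `(∂f/∂X_i)(a)` (`Δ_{e_i} = ∂/∂X_i`, the tree's `Literature.RingTheory.MvPowerSeries.pd`),
and compatibility with ring homomorphisms (`map_taylorAt`). Everything is proved; the two
definitions are the only new notions.

## References

* N. Bourbaki, *Algèbre commutative*, Ch. III §4 no. 5, Prop. 6 and formulas (18), (21), (22).
  [Bourbaki1989CommAlg]
-/

noncomputable section

namespace Literature.RingTheory.MvPowerSeries

open _root_.MvPowerSeries Finset

universe u v

variable {A : Type u} [CommRing A] {τ : Type v}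

/-! ### Divided partial derivatives -/

/-- The **divided (Hasse) partial derivative** `Δ_α = (1/α!) ∂^α` of formal power series,
defined over any commutative ring by its action on coefficients:
`coeff β (Δ_α f) = C(α+β, α) · coeff (α+β) f` with the multi-index binomial
`C(α+β, α) = Π_s C(α_s + β_s, α_s)`; these are the coefficients of `Y^α` in `f(X + Y)`
(Bourbaki's `G`'s in formula (21)). [cite: Bourbaki1989CommAlg, Ch. III §4 no. 5 (21)] -/
def hasseDeriv (α : τ →₀ ℕ) : MvPowerSeries τ A →ₗ[A] MvPowerSeries τ A where
  toFun f := fun β => (((α + β).prod fun s n => n.choose (α s) : ℕ) : A) * coeff (α + β) f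
  map_add' f g := by
    ext β
    show (_ : A) * coeff (α + β) (f + g) = _ * coeff (α + β) f + _ * coeff (α + β) g
    rw [map_add, mul_add]
  map_smul' c f := by
    ext β
    show (_ : A) * coeff (α + β) (c • f) = c • ((_ : A) * coeff (α + β) f)
    rw [map_smul, smul_eq_mul, smul_eq_mul, mul_left_comm]

/-- Coefficients of `Δ_α f`. [cite: Bourbaki1989CommAlg, Ch. III §4 no. 5 (21)] -/
theorem coeff_hasseDeriv (α β : τ →₀ ℕ) (f : MvPowerSeries τ A) :
    coeff β (hasseDeriv α f) =
      (((α + β).prod fun s n => n.choose (α s) : ℕ) : A) * coeff (α + β) f :=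
  rfl

/-- The multi-index binomial as a product over all indices (finite `τ`).
[cite: Bourbaki1989CommAlg, Ch. III §4 no. 5 (21)] -/
theorem prod_choose_eq [Fintype τ] (α β : τ →₀ ℕ) :
    ((α + β).prod fun s n => n.choose (α s)) = ∏ s, (α s + β s).choose (α s) := by
  rw [Finsupp.prod]
  refine (Finset.prod_subset (Finset.subset_univ (α + β).support) fun s _ hs => ?_).trans
    (Finset.prod_congr rfl fun s _ => by rw [Finsupp.add_apply])
  rw [Finsupp.mem_support_iff, not_not] at hs
  have hα : α s = 0 := by
    have : α s + β s = 0 := by rw [← Finsupp.add_apply]; exact hs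
    omega
  rw [hs, hα, Nat.choose_zero_right]

/-- `Δ_0 = id`. [cite: Bourbaki1989CommAlg, Ch. III §4 no. 5 (21)] -/
theorem hasseDeriv_zero (f : MvPowerSeries τ A) : hasseDeriv 0 f = f := by
  ext β
  rw [coeff_hasseDeriv]
  simp [Finsupp.prod]

/-- `Δ_{e_i} = ∂/∂X_i` (the first divided derivatives are the partial derivatives, here the tree's
coefficientwise `pd`). [cite: Bourbaki1989CommAlg, Ch. III §4 no. 5 (21)] -/
theorem hasseDeriv_single_eq_pd [DecidableEq τ] (i : τ) (f : MvPowerSeries τ A) :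
    hasseDeriv (Finsupp.single i 1) f = pd i f := by
  ext β
  rw [coeff_hasseDeriv, coeff_pd, add_comm (Finsupp.single i 1) β]
  congr 2
  rw [Finsupp.prod]
  rw [Finset.prod_eq_single i]
  · rw [Finsupp.add_apply, Finsupp.single_eq_same, Nat.choose_one_right]
  · intro s _ hsi
    rw [Finsupp.single_eq_of_ne hsi, Nat.choose_zero_right]
  · intro hi
    exfalso
    rw [Finsupp.mem_support_iff, Finsupp.add_apply, Finsupp.single_eq_same] at hi
    omega

/-- `Δ_α` commutes with coefficientwise ring homomorphisms.
[cite: Bourbaki1989CommAlg, Ch. III §4 no. 5 (21)] -/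
theorem map_hasseDeriv {B : Type*} [CommRing B] (φ : A →+* B) (α : τ →₀ ℕ)
    (f : MvPowerSeries τ A) :
    MvPowerSeries.map φ (hasseDeriv α f) = hasseDeriv α (MvPowerSeries.map φ f) := by
  ext β
  rw [coeff_map, coeff_hasseDeriv, coeff_hasseDeriv, map_mul, map_natCast, coeff_map]

/-! ### The Taylor series at a point of `I^τ` -/

/-- **Taylor re-expansion at a topologically nilpotent point**: for an ideal `I`, a point
`a : τ → A` and `f ∈ A⟦X⟧`, `taylorAt I a f = Σ_α (Δ_α f)(a) · Y^α ∈ A⟦Y⟧` is the series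
`f(a + Y)` (Bourbaki: substitute `a` for `X` in the coefficients of `f(X + Y) ∈ A⟦X, Y⟧`,
formulas (21)–(22)); meaningful for `A` `I`-adically complete and `a ∈ I^τ`.
[cite: Bourbaki1989CommAlg, Ch. III §4 no. 5 (22)] -/
def taylorAt (I : Ideal A) (a : τ → A) (f : MvPowerSeries τ A) : MvPowerSeries τ A :=
  fun α => adicEval I a (hasseDeriv α f)

/-- Coefficients of the Taylor series. [cite: Bourbaki1989CommAlg, Ch. III §4 no. 5 (22)] -/
theorem coeff_taylorAt (I : Ideal A) (a : τ → A) (f : MvPowerSeries τ A) (α : τ →₀ ℕ) :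
    coeff α (taylorAt I a f) = adicEval I a (hasseDeriv α f) :=
  rfl

/-- The constant term of `f(a + Y)` is `f(a)`. [cite: Bourbaki1989CommAlg, Ch. III §4 no. 5 (22)] -/
theorem constantCoeff_taylorAt (I : Ideal A) (a : τ → A) (f : MvPowerSeries τ A) :
    constantCoeff (taylorAt I a f) = adicEval I a f := by
  rw [← coeff_zero_eq_constantCoeff_apply, coeff_taylorAt, hasseDeriv_zero]

/-- The coefficient of `Y_i` in `f(a + Y)` is `(∂f/∂X_i)(a)` (the matrix `M_f(a)` of (22)).
[cite: Bourbaki1989CommAlg, Ch. III §4 no. 5 (22)] -/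
theorem coeff_single_taylorAt [DecidableEq τ] (I : Ideal A) (a : τ → A) (f : MvPowerSeries τ A)
    (i : τ) : coeff (Finsupp.single i 1) (taylorAt I a f) = adicEval I a (pd i f) := by
  rw [coeff_taylorAt, hasseDeriv_single_eq_pd]

/-- The Taylor series commutes with ring homomorphisms `φ : A → B` mapping `I` into `I'`
(`B` complete for `I'`, `a ∈ I^τ`). [cite: Bourbaki1989CommAlg, Ch. III §4 no. 5 Prop. 6] -/
theorem map_taylorAt {I : Ideal A} [IsAdicComplete I A] {B : Type*} [CommRing B] {I' : Ideal B}
    [IsAdicComplete I' B] [Finite τ] (φ : A →+* B) (hφ : I.map φ ≤ I') {a : τ → A}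
    (ha : ∀ s, a s ∈ I) (f : MvPowerSeries τ A) :
    MvPowerSeries.map φ (taylorAt I a f) =
      taylorAt I' (fun s => φ (a s)) (MvPowerSeries.map φ f) := by
  ext α
  rw [coeff_map, coeff_taylorAt, coeff_taylorAt, map_adicEval φ hφ ha, map_hasseDeriv]

/-! ### The Taylor expansion `f(a + z) = f(a + Y)|_{Y = z}` -/

section Expansion

variable [Fintype τ] [DecidableEq τ]

/-- Binomial expansion of a monomial: `Π_s (z_s + a_s)^{e_s} = Σ_{α ≤ e} C(e, α) z^α a^{e-α}`.
[cite: Bourbaki1989CommAlg, Ch. III §4 no. 5 (21)] -/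
theorem prod_add_pow_eq_sum (z a : τ → A) (e : τ →₀ ℕ) :
    ∏ s, (z s + a s) ^ e s =
      ∑ α ∈ Finset.Iic e, (∏ s, ((e s).choose (α s) : A)) *
        ((∏ s, z s ^ α s) * ∏ s, a s ^ (e s - α s)) := by
  classical
  have hstep : ∏ s, (z s + a s) ^ e s =
      ∏ s, ∑ k ∈ Finset.range (e s + 1), z s ^ k * a s ^ (e s - k) * ((e s).choose k : A) :=
    Finset.prod_congr rfl fun s _ => add_pow (z s) (a s) (e s)
  rw [hstep, Finset.prod_univ_sum]
  -- reindex functions `g` with `g s ≤ e s` by finsupps `α ≤ e`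
  refine Finset.sum_nbij' (fun g => Finsupp.equivFunOnFinite.symm g) (fun α => ⇑α) ?_ ?_ ?_ ?_ ?_
  · intro g hg
    rw [Fintype.mem_piFinset] at hg
    rw [Finset.mem_Iic]
    intro s
    have := hg s
    rw [Finset.mem_range] at this
    show Finsupp.equivFunOnFinite.symm g s ≤ e s
    rw [Finsupp.coe_equivFunOnFinite_symm]
    omega
  · intro α hα
    rw [Finset.mem_Iic] at hα
    rw [Fintype.mem_piFinset]
    intro s
    rw [Finset.mem_range]
    exact Nat.lt_succ_of_le (hα s)
  · intro g _
    funext s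
    simp
  · intro α _
    ext s
    simp
  · intro g _
    simp only [Finsupp.coe_equivFunOnFinite_symm]
    rw [Finset.prod_mul_distrib, Finset.prod_mul_distrib]
    ring

omit [Fintype τ] [DecidableEq τ] in
/-- Degrees under truncated subtraction of exponents: for `α ≤ e`,
`|e - α| + |α| = |e|`. [cite: Bourbaki1989CommAlg, Ch. III §4 no. 5 (21)] -/
theorem degree_tsub_add_degree {α e : τ →₀ ℕ} (h : α ≤ e) :
    (e - α).degree + α.degree = e.degree := by
  rw [← map_add, tsub_add_cancel_of_le h]

variable {I : Ideal A} [IsAdicComplete I A]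

/-- The finite (truncated) Taylor identity behind the expansion: for every `N`,
`Σ_{|e|<N} f_e (a+z)^e = Σ_{|α|<N} z^α · Σ_{|β|<N-|α|} C(α+β,α) f_{α+β} a^β`.
[cite: Bourbaki1989CommAlg, Ch. III §4 no. 5 (21)] -/
theorem eval_truncTotal_add_eq (f : MvPowerSeries τ A) (a z : τ → A) (N : ℕ) :
    MvPolynomial.eval (a + z) (truncTotal N f) =
      ∑ α ∈ (Finsupp.finite_of_degree_lt (σ := τ) N).toFinset,
        (∏ s, z s ^ α s) *
          MvPolynomial.eval a (truncTotal (N - α.degree) (hasseDeriv α f)) := by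
  classical
  set SN : Finset (τ →₀ ℕ) := (Finsupp.finite_of_degree_lt (σ := τ) N).toFinset with hSN
  have hmemSN : ∀ e : τ →₀ ℕ, e ∈ SN ↔ e.degree < N := fun e => by
    rw [hSN, Set.Finite.mem_toFinset, Set.mem_setOf_eq]
  -- evaluation of a total-degree truncation as a sum over `{|e| < M}`
  have heval : ∀ (M : ℕ) (g : MvPowerSeries τ A) (x : τ → A),
      MvPolynomial.eval x (truncTotal M g) =
        ∑ e ∈ (Finsupp.finite_of_degree_lt (σ := τ) M).toFinset,
          coeff e g * ∏ s, x s ^ e s := by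
    intro M g x
    rw [MvPolynomial.eval_eq']
    have hsub : ∑ e ∈ (truncTotal M g).support,
        MvPolynomial.coeff e (truncTotal M g) * ∏ s, x s ^ e s =
        ∑ e ∈ (Finsupp.finite_of_degree_lt (σ := τ) M).toFinset,
          MvPolynomial.coeff e (truncTotal M g) * ∏ s, x s ^ e s := by
      refine Finset.sum_subset (fun e he => ?_) (fun e _ hes => ?_)
      · rw [Set.Finite.mem_toFinset, Set.mem_setOf_eq]
        by_contra hlt
        rw [MvPolynomial.mem_support_iff, coeff_truncTotal_eq_zero _ (not_lt.mp hlt)] at he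
        exact he rfl
      · rw [MvPolynomial.notMem_support_iff] at hes
        rw [hes, zero_mul]
    rw [hsub]
    refine Finset.sum_congr rfl fun e he => ?_
    rw [Set.Finite.mem_toFinset, Set.mem_setOf_eq] at he
    rw [coeff_truncTotal _ he]
  rw [heval N f (a + z)]
  simp_rw [heval]
  -- expand `(a+z)^e` binomially and swap the sums
  have hlhs : ∑ e ∈ SN, coeff e f * ∏ s, (a + z) s ^ e s =
      ∑ e ∈ SN, ∑ α ∈ Finset.Iic e, coeff e f * ((∏ s, ((e s).choose (α s) : A)) *
        ((∏ s, z s ^ α s) * ∏ s, a s ^ (e s - α s))) := by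
    refine Finset.sum_congr rfl fun e _ => ?_
    have : (∏ s, (a + z) s ^ e s) = ∏ s, (z s + a s) ^ e s :=
      Finset.prod_congr rfl fun s _ => by rw [Pi.add_apply, add_comm]
    rw [this, prod_add_pow_eq_sum, Finset.mul_sum]
  rw [← hSN, hlhs]
  rw [Finset.sum_comm' (t' := SN) (s' := fun α => SN.filter fun e => α ≤ e) (fun e α => by
    rw [Finset.mem_Iic, Finset.mem_filter]
    constructor
    · rintro ⟨he, hα⟩
      refine ⟨⟨he, hα⟩, ?_⟩
      rw [hmemSN] at he ⊢
      exact lt_of_le_of_lt (Finsupp.degree_mono hα) he  -- degree monotone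
    · rintro ⟨⟨he, hα⟩, _⟩
      exact ⟨he, hα⟩)]
  refine Finset.sum_congr rfl fun α hα => ?_
  rw [hmemSN] at hα
  rw [Finset.mul_sum]
  -- reindex `e = α + β`
  symm
  refine Finset.sum_nbij' (fun β => α + β) (fun e => e - α) ?_ ?_ ?_ ?_ ?_
  · intro β hβ
    rw [Set.Finite.mem_toFinset, Set.mem_setOf_eq] at hβ
    rw [Finset.mem_filter, hmemSN, map_add]
    exact ⟨by omega, le_add_right le_rfl⟩
  · intro e he
    rw [Finset.mem_filter, hmemSN] at he
    rw [Set.Finite.mem_toFinset, Set.mem_setOf_eq]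
    have := degree_tsub_add_degree he.2
    omega
  · intro β _
    exact add_tsub_cancel_left _ _
  · intro e he
    rw [Finset.mem_filter] at he
    exact add_tsub_cancel_of_le he.2
  · intro β _
    rw [coeff_hasseDeriv, prod_choose_eq, Nat.cast_prod]
    have h1 : (∏ s, a s ^ ((α + β) s - α s)) = ∏ s, a s ^ β s :=
      Finset.prod_congr rfl fun s _ => by rw [Finsupp.add_apply, add_tsub_cancel_left]
    have h2 : (∏ s, (((α + β) s).choose (α s) : A)) = ∏ s, ((α s + β s).choose (α s) : A) :=
      Finset.prod_congr rfl fun s _ => by rw [Finsupp.add_apply]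
    rw [h1, h2]
    ring

/-- **Taylor expansion at a point of `I^τ`**: for `A` complete and separated in the `I`-adic
topology, `f ∈ A⟦X⟧`, and `a, z ∈ I^τ`, `f(a + z) = (f(a + Y))(z)`, i.e.
`f(a + z) = Σ_α (Δ_α f)(a) z^α` — Bourbaki's (22) `f(a + x) = f(a) + M_f(a)·x + (order ≥ 2)`
with the remainder made explicit. [cite: Bourbaki1989CommAlg, Ch. III §4 no. 5 (22)] -/
theorem adicEval_add_eq_adicEval_taylorAt {a z : τ → A} (ha : ∀ s, a s ∈ I)
    (hz : ∀ s, z s ∈ I) (f : MvPowerSeries τ A) :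
    adicEval I (a + z) f = adicEval I z (taylorAt I a f) := by
  classical
  have haz : ∀ s, (a + z) s ∈ I := fun s => I.add_mem (ha s) (hz s)
  refine eq_of_forall_sub_mem_pow (I := I) fun N => ?_
  -- both sides are congruent mod `I^N` to the same finite sum
  have h1 := adicEval_sub_eval_truncTotal_mem_pow haz f N
  have h2 := adicEval_sub_eval_truncTotal_mem_pow hz (taylorAt I a f) N
  rw [eval_truncTotal_add_eq] at h1
  -- the truncation of the Taylor series, evaluated at `z`, versus the finite sum of `h1`
  have h3 : MvPolynomial.eval z (truncTotal N (taylorAt I a f)) -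
      ∑ α ∈ (Finsupp.finite_of_degree_lt (σ := τ) N).toFinset,
        (∏ s, z s ^ α s) * MvPolynomial.eval a (truncTotal (N - α.degree) (hasseDeriv α f)) ∈
      I ^ N := by
    rw [MvPolynomial.eval_eq']
    have hsub : ∑ e ∈ (truncTotal N (taylorAt I a f)).support,
        MvPolynomial.coeff e (truncTotal N (taylorAt I a f)) * ∏ s, z s ^ e s =
        ∑ e ∈ (Finsupp.finite_of_degree_lt (σ := τ) N).toFinset,
          coeff e (taylorAt I a f) * ∏ s, z s ^ e s := by
      have hsub' : ∑ e ∈ (truncTotal N (taylorAt I a f)).support,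
          MvPolynomial.coeff e (truncTotal N (taylorAt I a f)) * ∏ s, z s ^ e s =
          ∑ e ∈ (Finsupp.finite_of_degree_lt (σ := τ) N).toFinset,
            MvPolynomial.coeff e (truncTotal N (taylorAt I a f)) * ∏ s, z s ^ e s := by
        refine Finset.sum_subset (fun e he => ?_) (fun e _ hes => ?_)
        · rw [Set.Finite.mem_toFinset, Set.mem_setOf_eq]
          by_contra hlt
          rw [MvPolynomial.mem_support_iff, coeff_truncTotal_eq_zero _ (not_lt.mp hlt)] at he
          exact he rfl
        · rw [MvPolynomial.notMem_support_iff] at hes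
          rw [hes, zero_mul]
      rw [hsub']
      refine Finset.sum_congr rfl fun e he => ?_
      rw [Set.Finite.mem_toFinset, Set.mem_setOf_eq] at he
      rw [coeff_truncTotal _ he]
    rw [hsub, ← Finset.sum_sub_distrib]
    refine (I ^ N).sum_mem fun α hα => ?_
    rw [Set.Finite.mem_toFinset, Set.mem_setOf_eq] at hα
    rw [coeff_taylorAt, mul_comm (∏ s, z s ^ α s), ← sub_mul]
    have hza : (∏ s, z s ^ α s) ∈ I ^ α.degree := by
      have := prod_pow_mem_pow_degree I hz α
      rwa [Finsupp.prod_fintype _ _ (fun s => pow_zero (z s))] at this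
    have hT := adicEval_sub_eval_truncTotal_mem_pow ha (hasseDeriv α f) (N - α.degree)
    have := Ideal.mul_mem_mul hT hza
    rwa [← pow_add, Nat.sub_add_cancel hα.le] at this
  have := (I ^ N).sub_mem ((I ^ N).sub_mem h1 h2) h3
  -- bookkeeping
  have e1 : adicEval I (a + z) f -
      ∑ α ∈ (Finsupp.finite_of_degree_lt (σ := τ) N).toFinset,
        (∏ s, z s ^ α s) * MvPolynomial.eval a (truncTotal (N - α.degree) (hasseDeriv α f)) -
      (adicEval I z (taylorAt I a f) - MvPolynomial.eval z (truncTotal N (taylorAt I a f))) -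
      (MvPolynomial.eval z (truncTotal N (taylorAt I a f)) -
        ∑ α ∈ (Finsupp.finite_of_degree_lt (σ := τ) N).toFinset,
          (∏ s, z s ^ α s) * MvPolynomial.eval a (truncTotal (N - α.degree) (hasseDeriv α f))) =
      adicEval I (a + z) f - adicEval I z (taylorAt I a f) := by ring
  rwa [e1] at this

end Expansion

end Literature.RingTheory.MvPowerSeries
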